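import Literature.Probability.LatticeModels.PointwiseScalingLimitScale
import Literature.Probability.LatticeModels.PointwiseScalingLimitEtaExists
import Mathlib.Analysis.SpecialFunctions.Log.Base
import HarnessLib

/-!
# Discrete scale invariance: a lattice family with every rigorous two-point feature of the critical
# Ising₃ correlators, a dyadic scaling limit, and NO full-filter pointwise scaling limit

Topic `Probability/LatticeModels`; family `crit-ising`. A counterexample file about the prelude notion
`HasPointwiseScalingLimit G ρ S` (`ScalingLimit.lean`: convergence along the FULL filter `δ → 0⁺`), in
the spirit of `PointwiseScalingLimitNotContinuous.lean`. Four definitions (`dsiProfile`, `dsiTwoPoint`,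
`dsiFamily`, `dsiLimitTwo`), no named facts.

The witness: the log-periodically modulated power law `W_ε(z) = ‖z‖_∞⁻¹ · exp(ε sin(2π log₂ ‖z‖_∞))`
on `ℤ³ ∖ {0}`, `W_ε(0) = 1`, as the pair function of the lattice family `dsiFamily ε` (order `0`: `1`;
all other orders `0`).

* SHARED WITH `criticalCorr 3` (all proved): lattice translation invariance (`dsiFamily_translate`),
  vanishing odd orders (`dsiFamily_odd`), symmetric pair function (`dsiFamily_two_comm`) invariant under
  the lattice point group (`dsiTwoPoint_perm`, `dsiTwoPoint_reflect`), `0 < W ≤ 1` (`dsiTwoPoint_pos`,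
  `dsiTwoPoint_le_one`, `|ε| ≤ 1/2`), and BOTH rigorous power bounds of `criticalTwoPoint_bounds` at
  `d = 3`: `c‖z‖^{-(3-1)} ≤ W ≤ C‖z‖^{-(3-2)}` (`dsiTwoPoint_bounds`).
* DYADIC LIMIT EXISTS (`dsi_dyadic_tendsto`): along `δ = 2^{-j}`, with `ρ(δ) = δ^{-1/2}`, the rescaled
  pair correlator of ANY family with pair function `W_ε` converges at every non-coincident pair to
  `dsiLimitTwo ε` — positive, continuous off the diagonal, translation invariant, `2`-covariant with
  `Δ = 1/2` (`dsiLimitTwo_two_smul`), and `3`-covariant for NO exponent (`dsiLimitTwo_not_three_covariant`).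
* NO FULL-FILTER LIMIT (`no_limit_of_hasDsiPair`, `dsiFamily_no_limit`): for `ε ≠ 0`, no family with pair
  function `W_ε` — whatever its higher correlations, e.g. the Wick completion — has a non-degenerate
  pointwise scaling limit along `𝓝[>] 0`, under ANY renormalisation: the renormalisation-free ratio
  `W(⌊3/δ⌋e₀)/W(⌊1/δ⌋e₀)` is the constant `3⁻¹e^{ε sin α}` along `δ = 2^{-j}` and the constant
  `3⁻¹e^{ε(sin 2α − sin α)}` along `δ = (3·2^j)⁻¹`, `α = 2π log₂ 3`, and these differ because
  `sin α ≠ 0` (`3 < log₂ 9 < 4`, `sin_two_pi_logb_three_ne_zero`).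
* `exists_discretelySelfSimilar_family` packages everything in one definition-free statement.

Consequence for the conformal-limit problem on `ℤ³` (crux `ExistsScaleCovariantLimit`, item
stmt-CriticalPhenomena-1981, which is pure existence of the full-filter limit): the full filter is
load-bearing — the known two-point information {translation invariance, point-group symmetry,
positivity, the two power bounds, sequential compactness} does not give it; a proof must use an input
about the n.n. Ising measure outside this list (on paper, not formalised here: `W_ε` is moreover
sup-norm-radially decreasing for `|ε| < ln 2/(2π)`, and log-periodically modulated power spectra are
Stieltjes in every pencil for small `ε`, so axis reflection positivity at the two-point level does not
exclude discrete scale invariance either). [folklore]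

References: D. Sornette, *Discrete scale invariance and complex dimensions*, Phys. Rep. 297 (1998)
239–270 (log-periodic corrections to scaling) — background only, nothing is cited from it; the
mathematics here is elementary.
-/

noncomputable section

open Filter Topology Set
open scoped Real

namespace Literature.Probability.LatticeModels

/-! ### The witness -/

/-- The log-periodic power profile `φ_ε(r) = r⁻¹ · exp(ε · sin(2π log₂ r))`. [folklore] -/
def dsiProfile (ε r : ℝ) : ℝ := r⁻¹ * Real.exp (ε * Real.sin (2 * π * Real.logb 2 r))

/-- The witness two-point function on `ℤ³`: `1` at `0`, `φ_ε(‖z‖_∞)` otherwise. [folklore] -/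
def dsiTwoPoint (ε : ℝ) (z : Site 3) : ℝ := if z = 0 then 1 else dsiProfile ε ‖z‖

/-- The witness lattice family `W_ε`: pair function `dsiTwoPoint ε (y₁ − y₀)`, `1` at order `0`,
`0` at every other order. [folklore] -/
def dsiFamily (ε : ℝ) : LatticeCorrFamily 3
  | 0, _ => 1
  | 2, y => dsiTwoPoint ε (y 1 - y 0)
  | _, _ => 0

/-! ### Elementary properties shared with `criticalCorr 3` -/

/-- `dsiProfile_pos` (elementary bookkeeping). [folklore] -/
theorem dsiProfile_pos (ε : ℝ) {r : ℝ} (hr : 0 < r) : 0 < dsiProfile ε r :=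
  mul_pos (inv_pos.2 hr) (Real.exp_pos _)

/-- `dsiTwoPoint_pos` (elementary bookkeeping for the witness). [folklore] -/
theorem dsiTwoPoint_pos (ε : ℝ) (z : Site 3) : 0 < dsiTwoPoint ε z := by
  unfold dsiTwoPoint
  split_ifs with h
  · exact one_pos
  · exact dsiProfile_pos ε (norm_pos_iff.2 h)

/-- `dsiTwoPoint_zero` (elementary bookkeeping for the witness). [folklore] -/
theorem dsiTwoPoint_zero (ε : ℝ) : dsiTwoPoint ε 0 = 1 := by simp [dsiTwoPoint]

/-- `dsiTwoPoint_neg` (elementary bookkeeping for the witness). [folklore] -/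
theorem dsiTwoPoint_neg (ε : ℝ) (z : Site 3) : dsiTwoPoint ε (-z) = dsiTwoPoint ε z := by
  unfold dsiTwoPoint
  simp only [neg_eq_zero, norm_neg]

/-- `dsiFamily_two` (elementary bookkeeping for the witness). [folklore] -/
theorem dsiFamily_two (ε : ℝ) (y : Fin 2 → Site 3) : dsiFamily ε 2 y = dsiTwoPoint ε (y 1 - y 0) := rfl

/-- `dsiFamily_zero` (elementary bookkeeping for the witness). [folklore] -/
theorem dsiFamily_zero (ε : ℝ) (y : Fin 0 → Site 3) : dsiFamily ε 0 y = 1 := rfl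

/-- Lattice translation invariance (as `criticalCorr_translate`). [folklore] -/
theorem dsiFamily_translate (ε : ℝ) {n : ℕ} (y : Fin n → Site 3) (v : Site 3) :
    dsiFamily ε n (fun i => y i + v) = dsiFamily ε n y := by
  match n with
  | 0 => rfl
  | 1 => rfl
  | 2 =>
    show dsiTwoPoint ε ((y 1 + v) - (y 0 + v)) = dsiTwoPoint ε (y 1 - y 0)
    congr 1; abel
  | _ + 3 => rfl

/-- Odd orders vanish (as `criticalCorr_eq_zero_of_odd`). [folklore] -/
theorem dsiFamily_odd (ε : ℝ) {n : ℕ} (hn : Odd n) (y : Fin n → Site 3) : dsiFamily ε n y = 0 := by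
  match n, hn with
  | 0, hn => exact absurd hn (by decide)
  | 1, _ => rfl
  | 2, hn => exact absurd hn (by decide)
  | _ + 3, _ => rfl

/-- Symmetry of the pair function (as `criticalCorr_two_pair_comm`). [folklore] -/
theorem dsiFamily_two_comm (ε : ℝ) (a b : Site 3) : dsiFamily ε 2 ![a, b] = dsiFamily ε 2 ![b, a] := by
  rw [dsiFamily_two, dsiFamily_two]
  simp only [Matrix.cons_val_one, Matrix.cons_val_fin_one, Matrix.cons_val_zero]
  rw [← dsiTwoPoint_neg, neg_sub]

/-- A non-zero lattice point has sup norm `≥ 1`. [folklore] -/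
theorem one_le_norm_of_ne_zero {z : Site 3} (hz : z ≠ 0) : (1:ℝ) ≤ ‖z‖ := by
  have h := norm_pos_iff.2 hz
  rw [Site.norm_eq_supNorm] at h ⊢
  exact_mod_cast (Nat.one_le_iff_ne_zero.2 (by exact_mod_cast h.ne'))

/-- **The two rigorous power bounds, same shape as `criticalTwoPoint_bounds` at `d = 3`**:
`c‖z‖^{-(3-1)} ≤ W ≤ C‖z‖^{-(3-2)}`. [folklore] -/
theorem dsiTwoPoint_bounds (ε : ℝ) : ∃ c C : ℝ, 0 < c ∧ ∀ z : Site 3, z ≠ 0 →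
    c * (‖z‖ : ℝ) ^ (-((3 : ℝ) - 1)) ≤ dsiTwoPoint ε z ∧
      dsiTwoPoint ε z ≤ C * (‖z‖ : ℝ) ^ (-((3 : ℝ) - 2)) := by
  refine ⟨Real.exp (-|ε|), Real.exp |ε|, Real.exp_pos _, fun z hz => ?_⟩
  have h1 := one_le_norm_of_ne_zero hz
  have hr : 0 < ‖z‖ := by linarith
  unfold dsiTwoPoint
  rw [if_neg hz]
  unfold dsiProfile
  have hsin : |ε * Real.sin (2 * π * Real.logb 2 ‖z‖)| ≤ |ε| := by
    rw [abs_mul]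
    exact mul_le_of_le_one_right (abs_nonneg _) (Real.abs_sin_le_one _)
  have hlo : Real.exp (-|ε|) ≤ Real.exp (ε * Real.sin (2 * π * Real.logb 2 ‖z‖)) :=
    Real.exp_le_exp.2 (by linarith [neg_abs_le (ε * Real.sin (2 * π * Real.logb 2 ‖z‖))])
  have hhi : Real.exp (ε * Real.sin (2 * π * Real.logb 2 ‖z‖)) ≤ Real.exp |ε| :=
    Real.exp_le_exp.2 (le_abs_self _ |>.trans hsin)
  have e2 : (‖z‖ : ℝ) ^ (-((3 : ℝ) - 1)) = (‖z‖ ^ 2)⁻¹ := by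
    rw [show (-((3:ℝ) - 1)) = -(2:ℝ) by norm_num, Real.rpow_neg hr.le, Real.rpow_two]
  have e1 : (‖z‖ : ℝ) ^ (-((3 : ℝ) - 2)) = ‖z‖⁻¹ := by
    rw [show (-((3:ℝ) - 2)) = -(1:ℝ) by norm_num, Real.rpow_neg_one]
  rw [e2, e1]
  constructor
  · have hsq : (‖z‖ ^ 2)⁻¹ ≤ ‖z‖⁻¹ := by
      rw [inv_le_inv₀ (by positivity) hr]
      nlinarith
    calc Real.exp (-|ε|) * (‖z‖ ^ 2)⁻¹ ≤ Real.exp (ε * Real.sin (2 * π * Real.logb 2 ‖z‖)) * ‖z‖⁻¹ :=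
          mul_le_mul hlo hsq (by positivity) (Real.exp_pos _).le
      _ = _ := by ring
  · rw [mul_comm]
    exact mul_le_mul_of_nonneg_right hhi (inv_nonneg.2 hr.le)

/-- `|W| ≤ 1` for `|ε| ≤ 1/2` (as `|⟨∏σ⟩| ≤ 1`). [folklore] -/
theorem dsiTwoPoint_le_one {ε : ℝ} (hε : |ε| ≤ 1/2) (z : Site 3) : dsiTwoPoint ε z ≤ 1 := by
  unfold dsiTwoPoint
  split_ifs with hz
  · exact le_rfl
  unfold dsiProfile
  have h1 := one_le_norm_of_ne_zero hz
  rcases h1.eq_or_lt with h | h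
  · rw [← h]; simp
  · -- `‖z‖ ≥ 2` (an integer `> 1`), and `exp(1/2) < 2`
    have h2 : (2:ℝ) ≤ ‖z‖ := by
      rw [Site.norm_eq_supNorm] at h ⊢
      exact_mod_cast (show 2 ≤ Site.supNorm z by exact_mod_cast h)
    have hexp : Real.exp (ε * Real.sin (2 * π * Real.logb 2 ‖z‖)) ≤ Real.exp (1/2) := by
      refine Real.exp_le_exp.2 ?_
      have : |ε * Real.sin (2 * π * Real.logb 2 ‖z‖)| ≤ 1/2 := by
        rw [abs_mul]
        exact (mul_le_of_le_one_right (abs_nonneg _) (Real.abs_sin_le_one _)).trans hε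
      exact (le_abs_self _).trans this
    have hhalf : Real.exp (1/2 : ℝ) < 2 := by
      have hsq : Real.exp (1/2 : ℝ) ^ 2 = Real.exp 1 := by
        rw [sq, ← Real.exp_add]; norm_num
      nlinarith [Real.exp_one_lt_d9, Real.exp_pos (1/2 : ℝ), hsq]
    rw [inv_mul_le_iff₀ (by linarith)]
    linarith

/-! ### The decisive arithmetic: `sin(2π log₂ 3) ≠ 0` -/

/-- `log₂ 9` is not an integer: `3 < log₂ 9 < 4`. [folklore] -/
theorem sin_two_pi_logb_three_ne_zero : Real.sin (2 * π * Real.logb 2 3) ≠ 0 := by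
  intro h
  obtain ⟨n, hn⟩ := Real.sin_eq_zero_iff.1 h
  have hpi : π ≠ 0 := Real.pi_ne_zero
  have hn' : (n : ℝ) = 2 * Real.logb 2 3 := by
    have := hn
    field_simp at this
    linarith
  have h9 : 2 * Real.logb 2 3 = Real.logb 2 9 := by
    rw [show (9:ℝ) = 3 ^ 2 by norm_num, Real.logb_pow]
    push_cast; ring
  rw [h9] at hn'
  have hlt : (3:ℝ) < Real.logb 2 9 := by
    rw [Real.lt_logb_iff_rpow_lt one_lt_two (by norm_num)]
    norm_num
  have hgt : Real.logb 2 9 < 4 := by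
    rw [Real.logb_lt_iff_lt_rpow one_lt_two (by norm_num)]
    norm_num
  rw [← hn'] at hlt hgt
  have h3 : (3:ℤ) < n := by exact_mod_cast hlt
  have h4 : n < (4:ℤ) := by exact_mod_cast hgt
  omega

/-! ### Axis bookkeeping -/

/-- `dsiTwoPoint_single_nat` (elementary bookkeeping). [folklore] -/
theorem dsiTwoPoint_single_nat (ε : ℝ) {m : ℕ} (hm : 0 < m) :
    dsiTwoPoint ε (Pi.single 0 (m : ℤ)) = dsiProfile ε m := by
  unfold dsiTwoPoint
  have hne : (Pi.single 0 (m : ℤ) : Site 3) ≠ 0 := by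
    intro h
    have := congrFun h 0
    simp at this
    omega
  rw [if_neg hne, norm_single_axis]
  push_cast
  rw [abs_of_nonneg (by positivity)]

/-- The rescaled pair correlator of such a `G` at the axis pair `(0, t e₀)`. [folklore] -/
theorem rescaled_dsi_axisPair {ε : ℝ} {G : LatticeCorrFamily 3}
    (hG : ∀ y : Fin 2 → Site 3, G 2 y = dsiTwoPoint ε (y 1 - y 0))
    (ρ : ℝ → ℝ) (δ t : ℝ) :
    rescaledCorrelator G ρ 2 δ
        ((![0, EuclideanSpace.single 0 t] : Fin 2 → EuclideanSpace ℝ (Fin 3))) =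
      ρ δ ^ 2 * dsiTwoPoint ε (Pi.single (0 : Fin 3) ⌊t / δ⌋) := by
  rw [rescaledCorrelator_apply, latticeApprox_comp_two, hG]
  simp only [Matrix.cons_val_zero, Matrix.cons_val_one, Matrix.cons_val_fin_one,
    latticeApprox_zero, sub_zero]
  congr 2
  funext i
  rw [latticeApprox_apply, PiLp.single_apply]
  by_cases hi : i = 0
  · subst hi; simp
  · rw [if_neg hi, Pi.single_eq_of_ne hi, zero_div, Int.floor_zero]

/-- `⌊a / (m⁻¹)⌋ = a·m` for naturals `a, m`. [folklore] -/
theorem floor_div_inv_nat (a m : ℕ) : ⌊(a : ℝ) / ((m : ℝ)⁻¹)⌋ = ((a * m : ℕ) : ℤ) := by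
  rw [div_inv_eq_mul, show (a : ℝ) * m = ((a * m : ℕ) : ℝ) by push_cast; ring, Int.floor_natCast]

/-- The ratio `φ_ε(3r)/φ_ε(r)` along `r = 2^j`: constant. [folklore] -/
theorem dsiProfile_ratio_pow (ε : ℝ) (j : ℕ) :
    dsiProfile ε ((3 * 2 ^ j : ℕ)) / dsiProfile ε ((2 ^ j : ℕ)) =
      3⁻¹ * Real.exp (ε * Real.sin (2 * π * Real.logb 2 3)) := by
  unfold dsiProfile
  have h2 : (0:ℝ) < 2 ^ j := by positivity
  have hl2 : Real.logb 2 ((2 ^ j : ℕ) : ℝ) = j := by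
    push_cast
    rw [Real.logb_pow, Real.logb_self_eq_one one_lt_two, mul_one]
  have hl3 : Real.logb 2 ((3 * 2 ^ j : ℕ) : ℝ) = Real.logb 2 3 + j := by
    push_cast
    rw [Real.logb_mul (by norm_num) h2.ne', Real.logb_pow, Real.logb_self_eq_one one_lt_two, mul_one]
  rw [hl2, hl3]
  have hs1 : Real.sin (2 * π * (j : ℝ)) = 0 := by
    rw [show 2 * π * (j:ℝ) = ((2 * j : ℕ) : ℝ) * π by push_cast; ring]
    exact Real.sin_nat_mul_pi _
  have hs2 : Real.sin (2 * π * (Real.logb 2 3 + j)) = Real.sin (2 * π * Real.logb 2 3) := by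
    rw [show 2 * π * (Real.logb 2 3 + j) = 2 * π * Real.logb 2 3 + j * (2 * π) by ring]
    exact Real.sin_add_nat_mul_two_pi _ _
  rw [hs1, hs2, mul_zero, Real.exp_zero, mul_one]
  push_cast
  field_simp

/-- The ratio `φ_ε(9r)/φ_ε(3r)` along `r = 2^j`: another constant. [folklore] -/
theorem dsiProfile_ratio_pow' (ε : ℝ) (j : ℕ) :
    dsiProfile ε ((3 * (3 * 2 ^ j) : ℕ)) / dsiProfile ε ((3 * 2 ^ j : ℕ)) =
      3⁻¹ * Real.exp (ε * (Real.sin (2 * (2 * π * Real.logb 2 3)) - Real.sin (2 * π * Real.logb 2 3))) := by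
  unfold dsiProfile
  have h2 : (0:ℝ) < 2 ^ j := by positivity
  have hl3 : Real.logb 2 ((3 * 2 ^ j : ℕ) : ℝ) = Real.logb 2 3 + j := by
    push_cast
    rw [Real.logb_mul (by norm_num) h2.ne', Real.logb_pow, Real.logb_self_eq_one one_lt_two, mul_one]
  have hl9 : Real.logb 2 ((3 * (3 * 2 ^ j) : ℕ) : ℝ) = 2 * Real.logb 2 3 + j := by
    push_cast
    rw [← mul_assoc, Real.logb_mul (by norm_num) h2.ne', Real.logb_pow, Real.logb_self_eq_one one_lt_two,
      mul_one, show (3:ℝ) * 3 = 3 ^ 2 by norm_num, Real.logb_pow]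
    push_cast; ring
  rw [hl3, hl9]
  have hs3 : Real.sin (2 * π * (Real.logb 2 3 + j)) = Real.sin (2 * π * Real.logb 2 3) := by
    rw [show 2 * π * (Real.logb 2 3 + j) = 2 * π * Real.logb 2 3 + j * (2 * π) by ring]
    exact Real.sin_add_nat_mul_two_pi _ _
  have hs9 : Real.sin (2 * π * (2 * Real.logb 2 3 + j)) = Real.sin (2 * (2 * π * Real.logb 2 3)) := by
    rw [show 2 * π * (2 * Real.logb 2 3 + j) = 2 * (2 * π * Real.logb 2 3) + j * (2 * π) by ring]
    exact Real.sin_add_nat_mul_two_pi _ _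
  rw [hs3, hs9]
  have hE : Real.exp (ε * Real.sin (2 * π * Real.logb 2 3)) ≠ 0 := (Real.exp_pos _).ne'
  rw [mul_sub, Real.exp_sub]
  push_cast
  field_simp

/-- The dyadic meshes `(2^j)⁻¹ → 0⁺` and `(3·2^j)⁻¹ → 0⁺`. [folklore] -/
theorem tendsto_inv_natMul_pow_nhdsGT {a : ℕ} (ha : 0 < a) :
    Tendsto (fun j : ℕ => (((a * 2 ^ j : ℕ) : ℝ))⁻¹) atTop (𝓝[>] (0:ℝ)) := by
  refine tendsto_nhdsWithin_iff.2 ⟨?_, Filter.Eventually.of_forall fun j => ?_⟩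
  · refine tendsto_inv_atTop_zero.comp ?_
    refine tendsto_natCast_atTop_atTop.comp ?_
    refine Filter.tendsto_atTop_mono (fun j => ?_) (tendsto_pow_atTop_atTop_of_one_lt one_lt_two)
    exact Nat.le_mul_of_pos_left _ ha
  · show (0:ℝ) < (((a * 2 ^ j : ℕ) : ℝ))⁻¹
    positivity

/-- The trigonometric endgame: `ε sin α = ε (sin 2α − sin α)` with `ε ≠ 0`, `α = 2π log₂ 3`, is
impossible. [folklore] -/
theorem dsi_trig_contra {ε : ℝ} (hε : ε ≠ 0)
    (heq : ε * Real.sin (2 * π * Real.logb 2 3) =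
      ε * (Real.sin (2 * (2 * π * Real.logb 2 3)) - Real.sin (2 * π * Real.logb 2 3))) : False := by
  set α : ℝ := 2 * π * Real.logb 2 3 with hα
  have heq' : Real.sin α = Real.sin (2 * α) - Real.sin α := mul_left_cancel₀ hε heq
  rw [Real.sin_two_mul] at heq'
  have hsin : Real.sin α ≠ 0 := sin_two_pi_logb_three_ne_zero
  have hcos : Real.cos α = 1 := by
    have : Real.sin α * (Real.cos α - 1) = 0 := by linarith
    rcases mul_eq_zero.1 this with h | h
    · exact absurd h hsin
    · linarith
  have : Real.sin α ^ 2 = 0 := by nlinarith [Real.sin_sq_add_cos_sq α]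
  exact hsin (pow_eq_zero_iff two_ne_zero |>.1 this)

/-- **NO FULL-FILTER LIMIT.** For `ε ≠ 0` the family `W_ε` has NO non-degenerate pointwise scaling
limit along the full filter `δ → 0⁺`, whatever the renormalisation: along `δ = 2^{-j}` and
`δ = (3·2^j)⁻¹` the renormalisation-free ratio `W(⌊3/δ⌋e₀)/W(⌊1/δ⌋e₀)` takes two different constant
values, since `sin(2π log₂ 3) ≠ 0`. [folklore] -/
theorem no_limit_of_hasDsiPair {ε : ℝ} (hε : ε ≠ 0) {G : LatticeCorrFamily 3}
    (hG : ∀ y : Fin 2 → Site 3, G 2 y = dsiTwoPoint ε (y 1 - y 0)) :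
    ¬ ∃ (ρ : ℝ → ℝ) (S : CorrFamily 3),
      HasPointwiseScalingLimit G ρ S ∧ IsNondegenerateTwoPoint S := by
  rintro ⟨ρ, S, hlim, hnd⟩
  have hx₁ := zero_unitVec_mem_nonCoincident (t := (1:ℝ)) one_ne_zero
  have hx₃ := zero_unitVec_mem_nonCoincident (t := (3:ℝ)) (by norm_num)
  have hA := hnd _ hx₁
  have h1 : Tendsto (fun δ => ρ δ ^ 2 * dsiTwoPoint ε (Pi.single 0 ⌊1 / δ⌋)) (𝓝[>] (0:ℝ))
      (𝓝 (S 2 (![0, EuclideanSpace.single 0 1] : Fin 2 → EuclideanSpace ℝ (Fin 3)))) := by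
    have h := (hlim 2).tendsto_at hx₁
    simp_rw [rescaled_dsi_axisPair hG] at h
    exact h
  have h3 : Tendsto (fun δ => ρ δ ^ 2 * dsiTwoPoint ε (Pi.single 0 ⌊3 / δ⌋)) (𝓝[>] (0:ℝ))
      (𝓝 (S 2 (![0, EuclideanSpace.single 0 3] : Fin 2 → EuclideanSpace ℝ (Fin 3)))) := by
    have h := (hlim 2).tendsto_at hx₃
    simp_rw [rescaled_dsi_axisPair hG] at h
    exact h
  -- the renormalisation-free ratio converges along the full filter
  set L : ℝ := S 2 (![0, EuclideanSpace.single 0 3] : Fin 2 → EuclideanSpace ℝ (Fin 3)) /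
    S 2 (![0, EuclideanSpace.single 0 1] : Fin 2 → EuclideanSpace ℝ (Fin 3)) with hL
  have hR : Tendsto (fun δ => dsiTwoPoint ε (Pi.single 0 ⌊3 / δ⌋) / dsiTwoPoint ε (Pi.single 0 ⌊1 / δ⌋))
      (𝓝[>] (0:ℝ)) (𝓝 L) := by
    have hq := h3.div h1 hA.ne'
    have hev : ∀ᶠ δ in 𝓝[>] (0:ℝ), ρ δ ≠ 0 := by
      filter_upwards [h1.eventually_const_lt hA] with δ hδ h0
      rw [h0] at hδ
      simp at hδ
    refine hq.congr' ?_
    filter_upwards [hev] with δ hδ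
    exact mul_div_mul_left _ _ (pow_ne_zero 2 hδ)
  -- along δ = (2^j)⁻¹
  have hu := hR.comp (tendsto_inv_natMul_pow_nhdsGT (a := 1) one_pos)
  have hw := hR.comp (tendsto_inv_natMul_pow_nhdsGT (a := 3) (by norm_num))
  have eu : (fun j : ℕ => dsiTwoPoint ε (Pi.single 0 ⌊3 / (((1 * 2 ^ j : ℕ) : ℝ))⁻¹⌋) /
      dsiTwoPoint ε (Pi.single 0 ⌊1 / (((1 * 2 ^ j : ℕ) : ℝ))⁻¹⌋)) =
      fun _ => 3⁻¹ * Real.exp (ε * Real.sin (2 * π * Real.logb 2 3)) := by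
    funext j
    have e3 : ⌊(3:ℝ) / (((1 * 2 ^ j : ℕ) : ℝ))⁻¹⌋ = ((3 * 2 ^ j : ℕ) : ℤ) := by
      have := floor_div_inv_nat 3 (1 * 2 ^ j)
      push_cast at this ⊢
      simpa [mul_comm, mul_assoc, mul_left_comm] using this
    have e1 : ⌊(1:ℝ) / (((1 * 2 ^ j : ℕ) : ℝ))⁻¹⌋ = ((2 ^ j : ℕ) : ℤ) := by
      have := floor_div_inv_nat 1 (1 * 2 ^ j)
      push_cast at this ⊢
      simpa using this
    rw [e3, e1, dsiTwoPoint_single_nat ε (by positivity), dsiTwoPoint_single_nat ε (by positivity)]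
    exact dsiProfile_ratio_pow ε j
  have ew : (fun j : ℕ => dsiTwoPoint ε (Pi.single 0 ⌊3 / (((3 * 2 ^ j : ℕ) : ℝ))⁻¹⌋) /
      dsiTwoPoint ε (Pi.single 0 ⌊1 / (((3 * 2 ^ j : ℕ) : ℝ))⁻¹⌋)) =
      fun _ => 3⁻¹ * Real.exp (ε * (Real.sin (2 * (2 * π * Real.logb 2 3)) - Real.sin (2 * π * Real.logb 2 3))) := by
    funext j
    have e3 : ⌊(3:ℝ) / (((3 * 2 ^ j : ℕ) : ℝ))⁻¹⌋ = ((3 * (3 * 2 ^ j) : ℕ) : ℤ) := by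
      have := floor_div_inv_nat 3 (3 * 2 ^ j)
      push_cast at this ⊢
      simpa [mul_comm, mul_assoc, mul_left_comm] using this
    have e1 : ⌊(1:ℝ) / (((3 * 2 ^ j : ℕ) : ℝ))⁻¹⌋ = ((3 * 2 ^ j : ℕ) : ℤ) := by
      have := floor_div_inv_nat 1 (3 * 2 ^ j)
      push_cast at this ⊢
      simpa using this
    rw [e3, e1, dsiTwoPoint_single_nat ε (by positivity), dsiTwoPoint_single_nat ε (by positivity)]
    exact dsiProfile_ratio_pow' ε j
  have Lu : L = 3⁻¹ * Real.exp (ε * Real.sin (2 * π * Real.logb 2 3)) := by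
    have hc : Tendsto (fun j : ℕ => dsiTwoPoint ε (Pi.single 0 ⌊3 / (((1 * 2 ^ j : ℕ) : ℝ))⁻¹⌋) /
        dsiTwoPoint ε (Pi.single 0 ⌊1 / (((1 * 2 ^ j : ℕ) : ℝ))⁻¹⌋)) atTop
        (𝓝 (3⁻¹ * Real.exp (ε * Real.sin (2 * π * Real.logb 2 3)))) := by
      rw [eu]; exact tendsto_const_nhds
    exact tendsto_nhds_unique hu hc
  have Lw : L = 3⁻¹ * Real.exp (ε * (Real.sin (2 * (2 * π * Real.logb 2 3)) - Real.sin (2 * π * Real.logb 2 3))) := by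
    have hc : Tendsto (fun j : ℕ => dsiTwoPoint ε (Pi.single 0 ⌊3 / (((3 * 2 ^ j : ℕ) : ℝ))⁻¹⌋) /
        dsiTwoPoint ε (Pi.single 0 ⌊1 / (((3 * 2 ^ j : ℕ) : ℝ))⁻¹⌋)) atTop
        (𝓝 (3⁻¹ * Real.exp (ε * (Real.sin (2 * (2 * π * Real.logb 2 3)) - Real.sin (2 * π * Real.logb 2 3))))) := by
      rw [ew]; exact tendsto_const_nhds
    exact tendsto_nhds_unique hw hc
  -- trigonometric contradiction
  refine dsi_trig_contra hε ?_
  have h := Lu.symm.trans Lw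
  exact Real.exp_injective (mul_left_cancel₀ (by norm_num : (3:ℝ)⁻¹ ≠ 0) h)

/-- In particular for `W_ε` itself. [folklore] -/
theorem dsiFamily_no_limit {ε : ℝ} (hε : ε ≠ 0) :
    ¬ ∃ (ρ : ℝ → ℝ) (S : CorrFamily 3),
      HasPointwiseScalingLimit (dsiFamily ε) ρ S ∧ IsNondegenerateTwoPoint S :=
  no_limit_of_hasDsiPair hε (fun _ => rfl)

/-! ### … yet the DYADIC scaling limit of the pair function exists and is non-degenerate -/

/-- The dyadic limit pair function: `φ_ε` of the sup-norm distance. [folklore] -/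
def dsiLimitTwo (ε : ℝ) (x : Fin 2 → EuclideanSpace ℝ (Fin 3)) : ℝ :=
  dsiProfile ε ‖WithLp.ofLp (x 1) - WithLp.ofLp (x 0)‖

/-- `dsiProfile_continuousOn` (elementary bookkeeping for the witness). [folklore] -/
theorem dsiProfile_continuousOn (ε : ℝ) : ContinuousOn (dsiProfile ε) {0}ᶜ := by
  unfold dsiProfile
  refine (continuousOn_inv₀.mono fun r hr => hr).mul ?_
  refine ContinuousOn.rexp ?_
  refine continuousOn_const.mul ?_
  refine Real.continuous_sin.comp_continuousOn ?_
  exact continuousOn_const.mul Real.continuousOn_logb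

/-- `dsiProfile_continuousAt` (elementary bookkeeping for the witness). [folklore] -/
theorem dsiProfile_continuousAt (ε : ℝ) {r : ℝ} (hr : r ≠ 0) : ContinuousAt (dsiProfile ε) r :=
  (dsiProfile_continuousOn ε).continuousAt (isOpen_compl_singleton.mem_nhds hr)

/-- `supDist_pos` (elementary bookkeeping for the witness). [folklore] -/
theorem supDist_pos {x : Fin 2 → EuclideanSpace ℝ (Fin 3)} (hx : x ∈ NonCoincident 3 2) :
    0 < ‖WithLp.ofLp (x 1) - WithLp.ofLp (x 0)‖ := by
  rw [norm_pos_iff, sub_ne_zero, (WithLp.ofLp_injective 2).ne_iff]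
  exact ((mem_nonCoincident x).1 hx).ne (by decide)

/-- `dsiLimitTwo_pos` (elementary bookkeeping for the witness). [folklore] -/
theorem dsiLimitTwo_pos (ε : ℝ) {x : Fin 2 → EuclideanSpace ℝ (Fin 3)} (hx : x ∈ NonCoincident 3 2) :
    0 < dsiLimitTwo ε x :=
  dsiProfile_pos ε (supDist_pos hx)

/-- The dyadic limit is continuous off the diagonal. [folklore] -/
theorem dsiLimitTwo_continuousOn (ε : ℝ) : ContinuousOn (dsiLimitTwo ε) (NonCoincident 3 2) := by
  have hd : Continuous fun x : Fin 2 → EuclideanSpace ℝ (Fin 3) => ‖WithLp.ofLp (x 1) - WithLp.ofLp (x 0)‖ := by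
    fun_prop
  refine (dsiProfile_continuousOn ε).comp hd.continuousOn fun x hx => ?_
  exact (supDist_pos hx).ne'

/-- The dyadic limit is translation invariant. [folklore] -/
theorem dsiLimitTwo_translate (ε : ℝ) (v : EuclideanSpace ℝ (Fin 3)) (x : Fin 2 → EuclideanSpace ℝ (Fin 3)) :
    dsiLimitTwo ε (fun i => x i + v) = dsiLimitTwo ε x := by
  unfold dsiLimitTwo
  congr 2
  simp only [WithLp.ofLp_add]
  abel

/-- The dyadic limit IS covariant under the dilation `2` (with `Δ = 1/2`: factor `2⁻¹`). [folklore] -/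
theorem dsiLimitTwo_two_smul (ε : ℝ) {x : Fin 2 → EuclideanSpace ℝ (Fin 3)} (hx : x ∈ NonCoincident 3 2) :
    dsiLimitTwo ε (fun i => (2:ℝ) • x i) = 2⁻¹ * dsiLimitTwo ε x := by
  unfold dsiLimitTwo dsiProfile
  have hr := supDist_pos hx
  set r : ℝ := ‖WithLp.ofLp (x 1) - WithLp.ofLp (x 0)‖ with hrdef
  have h2 : ‖WithLp.ofLp ((2:ℝ) • x 1) - WithLp.ofLp ((2:ℝ) • x 0)‖ = 2 * r := by
    rw [WithLp.ofLp_smul, WithLp.ofLp_smul, ← smul_sub, norm_smul, Real.norm_eq_abs, abs_two]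
  rw [h2, Real.logb_mul two_ne_zero hr.ne', Real.logb_self_eq_one one_lt_two,
    show 2 * π * (1 + Real.logb 2 r) = 2 * π * Real.logb 2 r + (1:ℕ) * (2 * π) by push_cast; ring,
    Real.sin_add_nat_mul_two_pi, mul_inv]
  ring

/-- … but NOT under the dilation `3`, for any exponent whatsoever (`ε ≠ 0`). [folklore] -/
theorem dsiLimitTwo_not_three_covariant {ε : ℝ} (hε : ε ≠ 0) :
    ¬ ∃ Δ : ℝ, ∀ x ∈ NonCoincident 3 2,
      dsiLimitTwo ε (fun i => (3:ℝ) • x i) = (3:ℝ) ^ (-(2:ℝ) * Δ) * dsiLimitTwo ε x := by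
  rintro ⟨Δ, h⟩
  have hx₁ := zero_unitVec_mem_nonCoincident (t := (1:ℝ)) one_ne_zero
  have hx₃ := zero_unitVec_mem_nonCoincident (t := (3:ℝ)) (by norm_num)
  have e₁ := h _ hx₁
  have e₃ := h _ hx₃
  -- distances `1`, `3`, `3`, `9`
  have d1 : ‖WithLp.ofLp ((![0, EuclideanSpace.single 0 1] : Fin 2 → EuclideanSpace ℝ (Fin 3)) 1) -
      WithLp.ofLp ((![0, EuclideanSpace.single 0 1] : Fin 2 → EuclideanSpace ℝ (Fin 3)) 0)‖ = 1 := by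
    simp only [Matrix.cons_val_zero, Matrix.cons_val_one, Matrix.cons_val_fin_one,
      WithLp.ofLp_zero, sub_zero, PiLp.ofLp_single, Pi.norm_single, Real.norm_eq_abs, abs_one]
  have d3 : ‖WithLp.ofLp ((![0, EuclideanSpace.single 0 3] : Fin 2 → EuclideanSpace ℝ (Fin 3)) 1) -
      WithLp.ofLp ((![0, EuclideanSpace.single 0 3] : Fin 2 → EuclideanSpace ℝ (Fin 3)) 0)‖ = 3 := by
    simp only [Matrix.cons_val_zero, Matrix.cons_val_one, Matrix.cons_val_fin_one,
      WithLp.ofLp_zero, sub_zero, PiLp.ofLp_single, Pi.norm_single, Real.norm_eq_abs]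
    norm_num
  have d3' : ‖WithLp.ofLp ((3:ℝ) • (![0, EuclideanSpace.single 0 1] : Fin 2 → EuclideanSpace ℝ (Fin 3)) 1) -
      WithLp.ofLp ((3:ℝ) • (![0, EuclideanSpace.single 0 1] : Fin 2 → EuclideanSpace ℝ (Fin 3)) 0)‖ = 3 := by
    rw [WithLp.ofLp_smul, WithLp.ofLp_smul, ← smul_sub, norm_smul, d1]; norm_num
  have d9 : ‖WithLp.ofLp ((3:ℝ) • (![0, EuclideanSpace.single 0 3] : Fin 2 → EuclideanSpace ℝ (Fin 3)) 1) -
      WithLp.ofLp ((3:ℝ) • (![0, EuclideanSpace.single 0 3] : Fin 2 → EuclideanSpace ℝ (Fin 3)) 0)‖ = 3 * 3 := by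
    rw [WithLp.ofLp_smul, WithLp.ofLp_smul, ← smul_sub, norm_smul, d3]; norm_num
  unfold dsiLimitTwo at e₁ e₃
  rw [d3', d1] at e₁
  rw [d9, d3] at e₃
  -- rewrite through the `2^j` ratio lemmas at `j = 0`
  have r1 := dsiProfile_ratio_pow ε 0
  have r2 := dsiProfile_ratio_pow' ε 0
  simp only [pow_zero, mul_one, Nat.cast_ofNat, Nat.cast_one, Nat.cast_mul] at r1 r2
  have hp1 : dsiProfile ε 1 ≠ 0 := (dsiProfile_pos ε one_pos).ne'
  have hp3 : dsiProfile ε 3 ≠ 0 := (dsiProfile_pos ε (by norm_num)).ne'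
  have q1 : dsiProfile ε 3 / dsiProfile ε 1 = (3:ℝ) ^ (-(2:ℝ) * Δ) := by
    rw [e₁, mul_div_assoc, div_self hp1, mul_one]
  have q2 : dsiProfile ε (3 * 3) / dsiProfile ε 3 = (3:ℝ) ^ (-(2:ℝ) * Δ) := by
    rw [e₃, mul_div_assoc, div_self hp3, mul_one]
  refine dsi_trig_contra hε ?_
  have h := (r1.symm.trans (q1.trans q2.symm)).trans r2
  exact Real.exp_injective (mul_left_cancel₀ (by norm_num : (3:ℝ)⁻¹ ≠ 0) h)

/-- **THE DYADIC SCALING LIMIT OF THE PAIR FUNCTION EXISTS** (pointwise at every non-coincident pair;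
renormalisation `ρ(δ) = δ^{-1/2}`, i.e. `Δ = 1/2`): along `δ = 2^{-j}` the rescaled pair correlator
of any family with the pair function `W_ε` converges to `dsiLimitTwo ε` — positive, continuous off
the diagonal, translation invariant, `2`-covariant. (Local uniformity also holds, by the same
estimate uniformly on compacts; not needed here.) [folklore] -/
theorem dsi_dyadic_tendsto {ε : ℝ} {G : LatticeCorrFamily 3}
    (hG : ∀ y : Fin 2 → Site 3, G 2 y = dsiTwoPoint ε (y 1 - y 0))
    {x : Fin 2 → EuclideanSpace ℝ (Fin 3)} (hx : x ∈ NonCoincident 3 2) :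
    Tendsto (fun j : ℕ => rescaledCorrelator G (fun δ => δ ^ (-(1/2:ℝ))) 2 (((2:ℝ) ^ j)⁻¹) x)
      atTop (𝓝 (dsiLimitTwo ε x)) := by
  have hr0 := supDist_pos hx
  set r : ℝ := ‖WithLp.ofLp (x 1) - WithLp.ofLp (x 0)‖ with hr
  set δ : ℕ → ℝ := fun j => ((2:ℝ) ^ j)⁻¹ with hδ
  have hδpos : ∀ j, 0 < δ j := fun j => by positivity
  have hδ0 : Tendsto δ atTop (𝓝 0) :=
    tendsto_inv_atTop_zero.comp (tendsto_pow_atTop_atTop_of_one_lt one_lt_two)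
  set z : ℕ → Site 3 := fun j => latticeApprox (δ j) (x 1) - latticeApprox (δ j) (x 0) with hz
  set t : ℕ → ℝ := fun j => δ j * ‖z j‖ with ht
  have hbd : ∀ j, r - 2 * δ j ≤ t j ∧ t j ≤ r + 2 * δ j := by
    intro j
    have hup := supNorm_latticeApprox_sub_le (hδpos j) (x 1) (x 0)
    have hlo := le_supNorm_latticeApprox_sub (d := 3) (by norm_num) (hδpos j) (x 1) (x 0)
    rw [← Site.norm_eq_supNorm] at hup hlo
    have hδj := hδpos j
    constructor
    · have := mul_le_mul_of_nonneg_left hlo hδj.le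
      rw [mul_sub, mul_div_cancel₀ _ hδj.ne'] at this
      show r - 2 * δ j ≤ δ j * ‖z j‖
      linarith
    · have := mul_le_mul_of_nonneg_left hup hδj.le
      rw [mul_add, mul_div_cancel₀ _ hδj.ne'] at this
      show δ j * ‖z j‖ ≤ r + 2 * δ j
      linarith
  have ht_t : Tendsto t atTop (𝓝 r) := by
    have hlo : Tendsto (fun j => r - 2 * δ j) atTop (𝓝 r) := by
      simpa using tendsto_const_nhds.sub (hδ0.const_mul 2)
    have hhi : Tendsto (fun j => r + 2 * δ j) atTop (𝓝 r) := by
      simpa using tendsto_const_nhds.add (hδ0.const_mul 2)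
    exact tendsto_of_tendsto_of_tendsto_of_le_of_le hlo hhi (fun j => (hbd j).1) fun j => (hbd j).2
  have hev : ∀ᶠ j in atTop, 0 < t j := ht_t.eventually (lt_mem_nhds hr0)
  have hid : ∀ j, 0 < t j → rescaledCorrelator G (fun δ => δ ^ (-(1/2:ℝ))) 2 (δ j) x = dsiProfile ε (t j) := by
    intro j htj
    have hz0 : z j ≠ 0 := by
      intro h
      have : t j = 0 := by show δ j * ‖z j‖ = 0; rw [h, norm_zero, mul_zero]
      rw [this] at htj
      exact lt_irrefl _ htj
    have hzpos : 0 < ‖z j‖ := norm_pos_iff.2 hz0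
    rw [rescaledCorrelator_apply, hG]
    show (δ j ^ (-(1/2:ℝ))) ^ 2 * dsiTwoPoint ε (z j) = dsiProfile ε (t j)
    unfold dsiTwoPoint
    rw [if_neg hz0]
    have hρ : (δ j ^ (-(1/2:ℝ))) ^ 2 = (δ j)⁻¹ := by
      rw [← Real.rpow_natCast, ← Real.rpow_mul (hδpos j).le]
      norm_num
      exact Real.rpow_neg_one _
    rw [hρ]
    unfold dsiProfile
    have hlog : Real.logb 2 ‖z j‖ = Real.logb 2 (t j) + j := by
      show Real.logb 2 ‖z j‖ = Real.logb 2 (δ j * ‖z j‖) + j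
      rw [Real.logb_mul (hδpos j).ne' hzpos.ne']
      show Real.logb 2 ‖z j‖ = Real.logb 2 (((2:ℝ) ^ j)⁻¹) + Real.logb 2 ‖z j‖ + j
      rw [Real.logb_inv, Real.logb_pow, Real.logb_self_eq_one one_lt_two]
      ring
    rw [hlog, show 2 * π * (Real.logb 2 (t j) + j) = 2 * π * Real.logb 2 (t j) + j * (2 * π) by ring,
      Real.sin_add_nat_mul_two_pi]
    show (δ j)⁻¹ * (‖z j‖⁻¹ * Real.exp (ε * Real.sin (2 * π * Real.logb 2 (t j)))) =
      (δ j * ‖z j‖)⁻¹ * Real.exp (ε * Real.sin (2 * π * Real.logb 2 (δ j * ‖z j‖)))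
    rw [mul_inv]
    ring
  have hcont : Tendsto (fun j => dsiProfile ε (t j)) atTop (𝓝 (dsiProfile ε r)) :=
    ((dsiProfile_continuousAt ε hr0.ne').tendsto).comp ht_t
  refine hcont.congr' ?_
  filter_upwards [hev] with j hj
  exact (hid j hj).symm

/-! ### Lattice point-group symmetry of `W_ε` (as for the n.n. Ising pair function) -/

/-- `dsiTwoPoint_eq_of_norm_eq` (elementary bookkeeping). [folklore] -/
theorem dsiTwoPoint_eq_of_norm_eq (ε : ℝ) {z z' : Site 3} (h : ‖z‖ = ‖z'‖) :
    dsiTwoPoint ε z = dsiTwoPoint ε z' := by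
  unfold dsiTwoPoint
  have hiff : z = 0 ↔ z' = 0 := by rw [← norm_eq_zero, h, norm_eq_zero]
  by_cases hz : z = 0
  · rw [if_pos hz, if_pos (hiff.1 hz)]
  · rw [if_neg hz, if_neg (mt hiff.2 hz), h]

/-- `norm_comp_perm` (elementary bookkeeping for the witness). [folklore] -/
theorem norm_comp_perm (z : Site 3) (σ : Equiv.Perm (Fin 3)) : ‖(fun i => z (σ i) : Site 3)‖ = ‖z‖ := by
  simp only [Pi.norm_def]
  congr 1
  apply le_antisymm
  · exact Finset.sup_le fun i _ => Finset.le_sup (f := fun b => ‖z b‖₊) (Finset.mem_univ (σ i))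
  · refine Finset.sup_le fun i _ => ?_
    have := Finset.le_sup (f := fun b => ‖(fun i => z (σ i) : Site 3) b‖₊) (Finset.mem_univ (σ.symm i))
    simpa using this

/-- `norm_update_neg` (elementary bookkeeping for the witness). [folklore] -/
theorem norm_update_neg (z : Site 3) (i : Fin 3) : ‖Function.update z i (-z i)‖ = ‖z‖ := by
  simp only [Pi.norm_def]
  congr 1
  refine Finset.sup_congr rfl fun b _ => ?_
  by_cases hb : b = i
  · subst hb; simp
  · simp [Function.update_of_ne hb]

/-- Coordinate permutations. [folklore] -/
theorem dsiTwoPoint_perm (ε : ℝ) (z : Site 3) (σ : Equiv.Perm (Fin 3)) :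
    dsiTwoPoint ε (fun i => z (σ i)) = dsiTwoPoint ε z :=
  dsiTwoPoint_eq_of_norm_eq ε (norm_comp_perm z σ)

/-- Coordinate sign changes. [folklore] -/
theorem dsiTwoPoint_reflect (ε : ℝ) (z : Site 3) (i : Fin 3) :
    dsiTwoPoint ε (Function.update z i (-z i)) = dsiTwoPoint ε z :=
  dsiTwoPoint_eq_of_norm_eq ε (norm_update_neg z i)

/-- **LOAD-BEARING SUMMARY (definition-free packaging, landable).** There is a lattice family on `ℤ³`
sharing with `criticalCorr 3` every two-point feature the tree knows — lattice translation
invariance, vanishing odd orders, symmetric pair function invariant under the lattice point group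
(coordinate permutations and sign changes), `0 < G₂ ≤ 1`, the two rigorous power bounds
`c‖z‖⁻² ≤ G₂ ≤ C‖z‖⁻¹` of `criticalTwoPoint_bounds` — whose rescaled pair correlators CONVERGE along the
dyadic meshes `2^{-j}` (renormalisation `δ^{-1/2}`) at every non-coincident pair to a positive,
continuous, translation-invariant, `2`-covariant function that is `3`-covariant for NO exponent, and
which admits NO non-degenerate pointwise scaling limit along the full filter `δ → 0⁺`, for ANY
renormalisation. So in the crux the full filter `𝓝[>] 0` is load-bearing, and any proof must consume an
input about the critical Ising correlators outside this list. [folklore] -/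
theorem exists_discretelySelfSimilar_family :
    ∃ G : LatticeCorrFamily 3,
      (∀ (n : ℕ) (y : Fin n → Site 3) (v : Site 3), G n (fun i => y i + v) = G n y) ∧
      (∀ n, Odd n → ∀ y : Fin n → Site 3, G n y = 0) ∧
      (∀ a b : Site 3, G 2 ![a, b] = G 2 ![b, a]) ∧
      (∀ (y : Fin 2 → Site 3) (σ : Equiv.Perm (Fin 3)), G 2 (fun k i => y k (σ i)) = G 2 y) ∧
      (∀ (y : Fin 2 → Site 3) (i : Fin 3), G 2 (fun k => Function.update (y k) i (-(y k i))) = G 2 y) ∧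
      (∀ y : Fin 2 → Site 3, 0 < G 2 y ∧ G 2 y ≤ 1) ∧
      (∃ c C : ℝ, 0 < c ∧ ∀ y : Fin 2 → Site 3, y 1 - y 0 ≠ 0 →
        c * ‖y 1 - y 0‖ ^ (-((3 : ℝ) - 1)) ≤ G 2 y ∧ G 2 y ≤ C * ‖y 1 - y 0‖ ^ (-((3 : ℝ) - 2))) ∧
      (∃ S₂ : (Fin 2 → EuclideanSpace ℝ (Fin 3)) → ℝ,
        (∀ x ∈ NonCoincident 3 2, 0 < S₂ x) ∧ ContinuousOn S₂ (NonCoincident 3 2) ∧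
        (∀ (v : EuclideanSpace ℝ (Fin 3)) (x : Fin 2 → EuclideanSpace ℝ (Fin 3)),
          S₂ (fun i => x i + v) = S₂ x) ∧
        (∀ x ∈ NonCoincident 3 2, S₂ (fun i => (2:ℝ) • x i) = 2⁻¹ * S₂ x) ∧
        (¬ ∃ Δ : ℝ, ∀ x ∈ NonCoincident 3 2, S₂ (fun i => (3:ℝ) • x i) = (3:ℝ) ^ (-(2:ℝ) * Δ) * S₂ x) ∧
        (∀ x ∈ NonCoincident 3 2, Tendsto
          (fun j : ℕ => rescaledCorrelator G (fun δ => δ ^ (-(1/2:ℝ))) 2 (((2:ℝ) ^ j)⁻¹) x)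
          atTop (𝓝 (S₂ x)))) ∧
      ¬ ∃ (ρ : ℝ → ℝ) (S : CorrFamily 3), HasPointwiseScalingLimit G ρ S ∧ IsNondegenerateTwoPoint S := by
  have hε : (1/4 : ℝ) ≠ 0 := by norm_num
  have hε' : |(1/4 : ℝ)| ≤ 1/2 := by rw [abs_of_pos (by norm_num)]; norm_num
  refine ⟨dsiFamily (1/4), fun n y v => dsiFamily_translate _ y v, fun n hn y => dsiFamily_odd _ hn y,
    dsiFamily_two_comm _, ?_, ?_, ?_, ?_, ?_, dsiFamily_no_limit hε⟩
  · intro y σ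
    rw [dsiFamily_two, dsiFamily_two]
    exact dsiTwoPoint_perm _ (y 1 - y 0) σ
  · intro y i
    rw [dsiFamily_two, dsiFamily_two]
    have h : Function.update (y 1) i (-y 1 i) - Function.update (y 0) i (-y 0 i) =
        Function.update (y 1 - y 0) i (-(y 1 - y 0) i) := by
      funext k
      by_cases hk : k = i
      · subst hk; simp; abel
      · simp [Function.update_of_ne hk]
    rw [h]
    exact dsiTwoPoint_reflect _ _ i
  · intro y
    rw [dsiFamily_two]
    exact ⟨dsiTwoPoint_pos _ _, dsiTwoPoint_le_one hε' _⟩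
  · obtain ⟨c, C, hc, hb⟩ := dsiTwoPoint_bounds (1/4)
    exact ⟨c, C, hc, fun y hy => by rw [dsiFamily_two]; exact hb _ hy⟩
  · exact ⟨dsiLimitTwo (1/4), fun x hx => dsiLimitTwo_pos _ hx, dsiLimitTwo_continuousOn _,
      dsiLimitTwo_translate _, fun x hx => dsiLimitTwo_two_smul _ hx,
      dsiLimitTwo_not_three_covariant hε, fun x hx => dsi_dyadic_tendsto (fun _ => rfl) hx⟩

end Literature.Probability.LatticeModels

end
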